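import Mathlib
import Summits.CriticalPhenomena.CardyFormulaZ2.Theorems.CardyMagicRigidityNestingRigidityUVExpMomentsAssembly
import Summits.CriticalPhenomena.CardyFormulaZ2.Theorems.CardyMagicRigidityNestingRigidityUVExpMomentsIndep
import Summits.CriticalPhenomena.CardyFormulaZ2.Theorems.CardyMagicRigidityNestingRigidityBigLoopsExpMomentBall
import HarnessLib

/-!
# Crux `NestingRigidity`, line `positive-cone-weight-doubling`: ONE SCALE of the multi-scale bound
# on the lattice ensembles — loop statistics of separated regions, dominated by big-loop counts

Crux `Summit.CriticalPhenomena.CardyFormulaZ2.Theses.CardyMagicRigidity.NestingRigidity`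
(stmt-CriticalPhenomena-4835), line `positive-cone-weight-doubling`, registered helper Ξ
`uvFarBite_expMoment_latticeEnsembles` (all-order CENTRED exponential moments of the far UV bite
statistic).  The abstract one-scale step `expMoment_centredSum_le_latticeEnsembles`
(…UVExpMomentsAssembly: cells coloured by `L` chessboard classes, cell statistics independent inside
each class and dominated by counts with a uniform exponential moment) is specialised here to the
shape in which the lattice supplies its two inputs (no cited fact, no definition):

* the cell statistics are INNER-LOOP STATISTICS `Y_i = Σ_{u ∈ X_δ, trace u ⊆ A_i, Q_i u} g u` of
  regions `A_i`, and regions of one class are pairwise more than `2δ` apart, so the `Y_i` of one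
  class are mutually independent on both lattices (`iIndepFun_finsum_innerLoops_latticeEnsembles`);
* each region sits in a window `B(x_i, R)`, the weight is bounded on the loops counted, `|g u| ≤ b`,
  and these loops satisfy a predicate `P` (e.g. a lower bound on the diameter), so
  `|Y_i| ≤ b · #{u ∈ X_δ : trace u ⊆ B(x_i, R), P u}` — a big-loop count whose exponential moments
  are keystone K6 at all centres and scales (`expMoment_ncard_bigLoops_le_ball_scale`, supplied by
  the caller as the hypothesis `E e^{(a+1) N_i} ≤ K`).

Registered anchor `expMoment_centredSum_sepRegions_le_latticeEnsembles`:
`E_δ exp(λ Σ_{i ∈ s} (Y_i − E_δ Y_i)) ≤ exp(2 · #s · L · λ² b² K²)` whenever `L|λ|b ≤ a`.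
-/

noncomputable section

open MeasureTheory ProbabilityTheory Set Filter Metric
open scoped Real Topology BigOperators

namespace Summit.CriticalPhenomena.CardyFormulaZ2.Cruxes.NestingRigidity.PositiveConeWeightDoubling

open Literature.Probability.RandomPlanarGeometry Literature.Probability.Percolation
  Literature.Probability.LatticeModels
open Summit.CriticalPhenomena.CardyFormulaZ2.Cruxes.NestingRigidity.RingCloudTomography

namespace UVFarBite

/-- **Domination of an inner-loop statistic by a loop count**: if the loops of `X_δ(ω)` inside `A`
with `Q` have `|g| ≤ b` and satisfy `P`, and `A ⊆ B(x, R)`, then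
`|Σ_{u ∈ X_δ, trace ⊆ A, Q u} g u| ≤ b · #{u ∈ X_δ : trace ⊆ B(x, R), P u}` (both lattices, fixed
mesh: the count is finite). -/
theorem abs_finsum_inner_le_mul_ncard : ∀ E ∈ latticeEnsembles, ∀ {δ : ℝ}, 0 < δ → ∀ (ω : E.Ω)
    (A : Set ℂ) (x : ℂ) (R : ℝ) (Q P : UnbasedLoop ℂ → Prop) (g : UnbasedLoop ℂ → ℝ) {b : ℝ}, 0 ≤ b →
    A ⊆ ball x R → (∀ u, u.range ⊆ A → Q u → |g u| ≤ b ∧ P u) →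
    |∑ᶠ u ∈ {u ∈ (E.X δ ω).loops | u.range ⊆ A ∧ Q u}, g u| ≤
      b * ({u ∈ (E.X δ ω).loops | u.range ⊆ ball x R ∧ P u}.ncard : ℝ) := by
  intro E hE δ hδ ω A x R Q P g b hb hA hg
  obtain ⟨N, hN⟩ := BigLoopsBall.exists_ncard_loops_sep_le_ball E hE hδ x R
  have hfin : {u ∈ (E.X δ ω).loops | u.range ⊆ ball x R ∧ P u}.Finite :=
    (hN (fun u ↦ u.range ⊆ ball x R ∧ P u) (fun u h ↦ h.1) ω).1
  have hsub : {u ∈ (E.X δ ω).loops | u.range ⊆ A ∧ Q u} ⊆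
      {u ∈ (E.X δ ω).loops | u.range ⊆ ball x R ∧ P u} :=
    fun u hu ↦ ⟨hu.1, hu.2.1.trans hA, (hg u hu.2.1 hu.2.2).2⟩
  have hfinS : {u ∈ (E.X δ ω).loops | u.range ⊆ A ∧ Q u}.Finite := hfin.subset hsub
  -- truncate `g` outside the family (there `|g| ≤ b` may fail)
  set g' : UnbasedLoop ℂ → ℝ := {u | u.range ⊆ A ∧ Q u}.indicator g with hg'
  have heq : ∑ᶠ u ∈ {u ∈ (E.X δ ω).loops | u.range ⊆ A ∧ Q u}, g u =
      ∑ᶠ u ∈ {u ∈ (E.X δ ω).loops | u.range ⊆ A ∧ Q u}, g' u :=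
    finsum_mem_congr rfl fun u hu ↦
      (Set.indicator_of_mem (show u ∈ {u | u.range ⊆ A ∧ Q u} from hu.2) g).symm
  have hg'b : ∀ u, |g' u| ≤ b := fun u ↦ by
    rw [hg']
    by_cases hu : u ∈ {u | u.range ⊆ A ∧ Q u}
    · rw [Set.indicator_of_mem hu]; exact (hg u hu.1 hu.2).1
    · rw [Set.indicator_of_notMem hu, abs_zero]; exact hb
  rw [heq]
  calc |∑ᶠ u ∈ {u ∈ (E.X δ ω).loops | u.range ⊆ A ∧ Q u}, g' u|
      ≤ b * ({u ∈ (E.X δ ω).loops | u.range ⊆ A ∧ Q u}.ncard : ℝ) :=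
        FirstMoment.abs_finsum_mem_le hfinS Set.inter_subset_left hb hg'b
    _ ≤ b * ({u ∈ (E.X δ ω).loops | u.range ⊆ ball x R ∧ P u}.ncard : ℝ) := by
        gcongr

end UVFarBite

/-- **One scale of the multi-scale bound behind Ξ `uvFarBite_expMoment_latticeEnsembles`, on both
lattice ensembles, with the lattice inputs built in** (registered helper, line
`positive-cone-weight-doubling`).  For `E ∈ latticeEnsembles`, mesh `δ > 0`, cells `i ∈ s` (any index
type) coloured by `L` classes `cls`, regions `A_i ⊆ ℂ` such that regions of DISTINCT cells of one
class are more than `2δ` apart, windows `A_i ⊆ B(x_i, R) ⊆ B(0, R₀)`, predicates `Q_i` cutting the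
cell families and a weight `g` with `|g u| ≤ b` and `P u` for every loop `u` inside `A_i` with `Q_i u`:
if the window counts `N_i = #{u ∈ X_δ : trace u ⊆ B(x_i, R), P u}` have `E_δ e^{(a+1) N_i} ≤ K`
(keystone K6 at all centres and scales) and `L|λ|b ≤ a`, then the cell statistics
`Y_i = Σ_{u ∈ X_δ, trace u ⊆ A_i, Q_i u} g u` satisfy
`E_δ exp(λ Σ_{i ∈ s} (Y_i − E_δ Y_i)) ≤ exp(2 · #s · L · λ² b² K²)` (integrability included): the
`Y_i` of one class are mutually independent (`iIndepFun_finsum_innerLoops_latticeEnsembles`),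
`|Y_i| ≤ b N_i`, and `expMoment_centredSum_le_latticeEnsembles` applies. -/
theorem expMoment_centredSum_sepRegions_le_latticeEnsembles : ∀ E ∈ latticeEnsembles, ∀ (δ : ℝ), 0 < δ →
    ∀ (ι : Type) (L : ℕ) (s : Finset ι) (cls : ι → Fin L) (A : ι → Set ℂ) (x : ι → ℂ) (R : ℝ)
    (Q : ι → UnbasedLoop ℂ → Prop) (P : UnbasedLoop ℂ → Prop) (g : UnbasedLoop ℂ → ℝ) (b a K l : ℝ),
    0 < L → 0 ≤ b →
    (∀ i j, i ≠ j → cls i = cls j → ∀ p ∈ A i, ∀ q ∈ A j, 2 * δ < dist p q) →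
    (∀ i ∈ s, A i ⊆ Metric.ball (x i) R) →
    (∀ i ∈ s, ∀ u : UnbasedLoop ℂ, u.range ⊆ A i → Q i u → |g u| ≤ b ∧ P u) →
    (∀ i ∈ s, Integrable (fun ω ↦ Real.exp ((a + 1) *
        ({u ∈ (E.X δ ω).loops | u.range ⊆ Metric.ball (x i) R ∧ P u}.ncard : ℝ))) E.P ∧
      ∫ ω, Real.exp ((a + 1) *
        ({u ∈ (E.X δ ω).loops | u.range ⊆ Metric.ball (x i) R ∧ P u}.ncard : ℝ)) ∂E.P ≤ K) →
    L * (|l| * b) ≤ a →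
    Integrable (fun ω ↦ Real.exp (l * ∑ i ∈ s,
      ((∑ᶠ u ∈ {u ∈ (E.X δ ω).loops | u.range ⊆ A i ∧ Q i u}, g u) -
        ∫ ω', (∑ᶠ u ∈ {u ∈ (E.X δ ω').loops | u.range ⊆ A i ∧ Q i u}, g u) ∂E.P))) E.P ∧
    ∫ ω, Real.exp (l * ∑ i ∈ s,
      ((∑ᶠ u ∈ {u ∈ (E.X δ ω).loops | u.range ⊆ A i ∧ Q i u}, g u) -
        ∫ ω', (∑ᶠ u ∈ {u ∈ (E.X δ ω').loops | u.range ⊆ A i ∧ Q i u}, g u) ∂E.P)) ∂E.P ≤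
      Real.exp (2 * s.card * L * l ^ 2 * b ^ 2 * K ^ 2) := by
  intro E hE δ hδ ι L s cls A x R Q P g b a K l hL hb hsep hA hg hK hl
  -- the cell statistics and the window counts
  set Y : ι → E.Ω → ℝ := fun i ω ↦ ∑ᶠ u ∈ {u ∈ (E.X δ ω).loops | u.range ⊆ A i ∧ Q i u}, g u with hY
  set N : ι → E.Ω → ℝ := fun i ω ↦
    ({u ∈ (E.X δ ω).loops | u.range ⊆ Metric.ball (x i) R ∧ P u}.ncard : ℝ) with hN
  have hYm : ∀ i, Measurable (Y i) := fun i ↦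
    FirstMoment.measurable_finsum_loops_sep E hE δ (fun u ↦ u.range ⊆ A i ∧ Q i u) g
  have hNm : ∀ i, Measurable (N i) := fun i ↦
    measurable_from_nat.comp (BigLoops.measurable_ncard_loops_sep E hE δ _)
  have hdom : ∀ i ∈ s, ∀ ω, |Y i ω| ≤ b * N i ω := fun i hi ω ↦
    UVFarBite.abs_finsum_inner_le_mul_ncard E hE hδ ω (A i) (x i) R (Q i) P g hb (hA i hi) (hg i hi)
  have hN0 : ∀ i ∈ s, ∀ ω, 0 ≤ N i ω := fun i _ ω ↦ Nat.cast_nonneg _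
  -- independence inside each class
  have hind : ∀ c : Fin L, iIndepFun (fun i : {i : ι // cls i = c} ↦ Y i.1) E.P := by
    intro c
    exact iIndepFun_finsum_innerLoops_latticeEnsembles E hE hδ.le {i : ι // cls i = c}
      (fun i ↦ A i.1) (fun i ↦ Q i.1) (fun _ ↦ g) fun k k' hkk' p hp q hq ↦
        hsep k.1 k'.1 (fun h ↦ hkk' (Subtype.ext h)) (k.2.trans k'.2.symm) p hp q hq
  exact expMoment_centredSum_le_latticeEnsembles E hE ι L s cls Y N b a K l hL hYm hNm hb hdom hN0 hK
    hind hl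

end Summit.CriticalPhenomena.CardyFormulaZ2.Cruxes.NestingRigidity.PositiveConeWeightDoubling

end
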